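import Mathlib
import Literature.LinearAlgebra.QuadraticForm.ArfInvariant

/-!
# Determinants of symmetric matrices over `𝔽₂`: peeling a vertex, unitized minors, contraction

Elementary determinant calculus used by the bipartite (all-minors) matrix-forest formula of
`Literature/LinearAlgebra/Matrix/BipartiteForestFormula.lean` and by Smith's Theorem 2.2
(A. Smith, *The congruent numbers have positive natural density*, arXiv:1603.08479, §2.1, whose
proof of Prop. 2.4 starts from the remark that for a SYMMETRIC matrix over `𝔽₂` the permutation
expansion of `det M` reduces to involutions, the terms of `σ` and `σ⁻¹` cancelling in pairs
[Smith2016CongruentDensity, §2.1, chunk p0006 L44–L48]).  In determinant language that remark is the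
**peeling formula** `det_eq_peel_of_decomp` below: for symmetric `N` over `𝔽₂`, a row index `v`, and
any decomposition `N v j = Σ_α c_α w_α j` of the off-diagonal part of row `v`,
`det N = N v v · det N⟨v⟩ + Σ_α c_α · det N⟨v ← w_α⟩`, where `N⟨v⟩` (`unitize`) replaces row and
column `v` by the unit vector and `N⟨v ← w⟩` (`symBorder`) replaces them by `w` (corner `0`); the cross
terms `c_α c_β (…)`, `α ≠ β`, cancel by symmetry and `2 = 0`, and `c_α² = c_α` in `𝔽₂`.
Companions: principal minors as determinants of unitized matrices (any commutative ring), the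
one-step row/column unitization identity `det (A.updateCol j e_v) = det (A.updateRow v e_j)`
(adjugate transpose), the evaluation of a unit symBorder (`det_border_single`) and the **contraction**
of a symBorder `e_u + e_u'` by the congruence with a transvection (`det_border_single_add_single`).
All statements are finite identities; the `𝔽₂`-specific ones are stated over `ZMod 2`.
-/

namespace Literature.LinearAlgebra.Matrix

open _root_.Matrix

variable {n : Type*} [Fintype n] [DecidableEq n]

section CommRing

variable {R : Type*} [CommRing R]

/-- `unitize N v`: the matrix `N` with row `v` and column `v` replaced by the unit vector `e_v`
(so that `det (unitize N v)` is the principal minor of `N` deleting `v`).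
[cite: ChebotarevAgaev2002, §3 Thm. 2 (principal minors `det L(J̄|J̄)` of a Laplacian)] -/
def unitize (N : Matrix n n R) (v : n) : Matrix n n R :=
  (N.updateRow v (Pi.single v 1)).updateCol v (Pi.single v 1)

/-- `symBorder N v w`: the matrix `N` with row `v` and column `v` both replaced by the vector `w`
(used with `w v = 0`, a "bordered" principal minor). [cite: Smith2016CongruentDensity, §2.2 (chunk p0008 L42, the bordered determinants `O(A, z, u)`)] -/
def symBorder (N : Matrix n n R) (v : n) (w : n → R) : Matrix n n R :=
  (N.updateRow v w).updateCol v w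

omit [Fintype n] in
/-- Entries of `unitize`. [cite: ChebotarevAgaev2002, §3 Thm. 2] -/
theorem unitize_apply (N : Matrix n n R) (v i j : n) :
    unitize N v i j = if j = v then (if i = v then 1 else 0) else (if i = v then 0 else N i j) := by
  unfold unitize
  rw [updateCol_apply]
  split_ifs with h1 h2 h3
  · subst h1; subst h2; simp
  · subst h1; simp [h2]
  · subst h3; simp [updateRow_self, h1]
  · rw [updateRow_ne h3]

omit [Fintype n] [CommRing R] in
/-- Entries of `symBorder`. [cite: Smith2016CongruentDensity, §2.2 (chunk p0008 L42)] -/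
theorem border_apply (N : Matrix n n R) (v : n) (w : n → R) (i j : n) :
    symBorder N v w i j = if j = v then w i else (if i = v then w j else N i j) := by
  unfold symBorder
  rw [updateCol_apply]
  split_ifs with h1 h2
  · rfl
  · subst h2; rw [updateRow_self]
  · rw [updateRow_ne h2]

omit [Fintype n] in
/-- `unitize` is symmetric when `N` is. [cite: ChebotarevAgaev2002, §3 Thm. 2] -/
theorem unitize_transpose (N : Matrix n n R) (v : n) : (unitize N v)ᵀ = unitize Nᵀ v := by
  ext i j
  rw [transpose_apply, unitize_apply, unitize_apply]
  by_cases hi : i = v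
  · by_cases hj : j = v
    · rw [if_pos hi, if_pos hj, if_pos hj, if_pos hi]
    · rw [if_pos hi, if_neg hj, if_neg hj, if_pos hi]
  · by_cases hj : j = v
    · rw [if_neg hi, if_pos hj, if_pos hj, if_neg hi]
    · rw [if_neg hi, if_neg hj, if_neg hj, if_neg hi, transpose_apply]

omit [Fintype n] [CommRing R] in
/-- `symBorder` is symmetric when `N` is. [cite: Smith2016CongruentDensity, §2.2 (chunk p0008 L42)] -/
theorem border_transpose (N : Matrix n n R) (v : n) (w : n → R) :
    (symBorder N v w)ᵀ = symBorder Nᵀ v w := by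
  ext i j
  simp only [transpose_apply, border_apply]
  by_cases hi : i = v <;> by_cases hj : j = v <;> simp [hi, hj]

/-- If row `v` of `X` is the unit vector `e_v`, replacing column `v` by `e_v` as well does not
change the determinant (expand along row `v`). [cite: ChebotarevAgaev2002, §3 Thm. 2] -/
theorem det_updateCol_single_of_row_eq_single (X : Matrix n n R) (v : n)
    (hv : X v = Pi.single v 1) : (X.updateCol v (Pi.single v 1)).det = X.det := by
  have hcol : (Pi.single v (1 : R) : n → R) =
      (fun i => X i v) + fun i => (Pi.single v (1 : R) : n → R) i - X i v := by
    ext i; simp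
  rw [hcol, det_updateCol_add, updateCol_eq_self]
  suffices h0 : (X.updateCol v fun i => (Pi.single v (1 : R) : n → R) i - X i v).det = 0 by
    rw [h0, add_zero]
  refine det_eq_zero_of_row_eq_zero v fun j => ?_
  rw [updateCol_apply]
  split_ifs with h
  · subst h; rw [hv]; simp
  · rw [hv]; simp [h]

/-- The determinant of the unitized matrix is the cofactor `adj N v v = det (N.updateRow v e_v)`,
i.e. the principal minor deleting `v`. [cite: ChebotarevAgaev2002, §3 Thm. 2] -/
theorem det_unitize (N : Matrix n n R) (v : n) :
    (unitize N v).det = (N.updateRow v (Pi.single v 1)).det := by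
  unfold unitize
  exact det_updateCol_single_of_row_eq_single _ v (updateRow_self)

/-- Two successive unitizations compute the principal minor deleting `{u, v}`:
`det (unitize (unitize N u) v) = det ((N.updateRow u e_u).updateRow v e_v)`.
[cite: ChebotarevAgaev2002, §3 Thm. 2] -/
theorem det_unitize_unitize (N : Matrix n n R) {u v : n} (huv : u ≠ v) :
    (unitize (unitize N u) v).det = ((N.updateRow u (Pi.single u 1)).updateRow v (Pi.single v 1)).det := by
  rw [det_unitize]
  have h : (unitize N u).updateRow v (Pi.single v 1) =
      (((N.updateRow u (Pi.single u 1)).updateRow v (Pi.single v 1))).updateCol u (Pi.single u 1) := by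
    ext i j
    simp only [unitize, updateRow_apply, updateCol_apply]
    split_ifs with h1 h2 <;> simp_all [Pi.single_apply]
  rw [h, det_updateCol_single_of_row_eq_single]
  rw [updateRow_ne huv, updateRow_self]

/-- One row/column unitization: `det (A.updateCol j e_v) = det (A.updateRow v e_j)` (both are the
cofactor `adj A j v`; adjugate of the transpose). [cite: Smith2016CongruentDensity, §2.1 (chunk p0006 L44–L48)] -/
theorem det_updateCol_single_eq_det_updateRow_single (A : Matrix n n R) (j v : n) :
    (A.updateCol j (Pi.single v 1)).det = (A.updateRow v (Pi.single j 1)).det := by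
  rw [← adjugate_apply, ← det_transpose, ← updateRow_transpose, ← adjugate_apply,
    ← adjugate_transpose, transpose_apply]

/-- For symmetric `N` and `i, k ≠ v`: the doubly row-unitized determinants
`det ((N.updateRow v e_i).updateRow k e_v)` are symmetric in `(i, k)` (transposed minors).
[cite: Smith2016CongruentDensity, §2.1 (chunk p0006 L44–L48: the terms of `σ` and `σ⁻¹` agree)] -/
theorem det_updateRow_updateRow_symm {N : Matrix n n R} (hN : Nᵀ = N) {v i k : n}
    (hi : i ≠ v) (hk : k ≠ v) :
    ((N.updateRow v (Pi.single i 1)).updateRow k (Pi.single v 1)).det =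
      ((N.updateRow v (Pi.single k 1)).updateRow i (Pi.single v 1)).det := by
  conv_rhs => rw [← det_transpose, ← updateCol_transpose, ← updateCol_transpose, hN,
    det_updateCol_single_eq_det_updateRow_single]
  have hc : (N.updateCol v (Pi.single k 1)).updateRow v (Pi.single i 1) =
      (N.updateRow v (Pi.single i 1)).updateCol v (Pi.single k 1) := by
    ext a b
    simp only [updateRow_apply, updateCol_apply]
    split_ifs with h1 h2
    · subst h1; subst h2; simp [hi, hk]
    · rfl
    · rfl
    · rfl
  rw [hc, det_updateCol_single_eq_det_updateRow_single]

/-- Linearity of the determinant in column `v`, finite-sum form.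
[cite: Smith2016CongruentDensity, §2.1 (chunk p0006 L66: "using multilinearity of determinant")] -/
theorem det_updateCol_finset_sum {ι : Type*} (Y : Matrix n n R) (v : n) (s : Finset ι)
    (f : ι → n → R) :
    (Y.updateCol v (∑ i ∈ s, f i)).det = ∑ i ∈ s, (Y.updateCol v (f i)).det := by
  classical
  induction s using Finset.induction_on with
  | empty =>
    rw [Finset.sum_empty, Finset.sum_empty]
    exact det_eq_zero_of_column_eq_zero v fun i => by simp
  | insert a s ha ih => rw [Finset.sum_insert ha, Finset.sum_insert ha, det_updateCol_add, ih]

/-- Linearity of the determinant in row `v`, finite-sum form.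
[cite: Smith2016CongruentDensity, §2.1 (chunk p0006 L66: "using multilinearity of determinant")] -/
theorem det_updateRow_finset_sum {ι : Type*} (Y : Matrix n n R) (v : n) (s : Finset ι)
    (f : ι → n → R) :
    (Y.updateRow v (∑ i ∈ s, f i)).det = ∑ i ∈ s, (Y.updateRow v (f i)).det := by
  classical
  induction s using Finset.induction_on with
  | empty =>
    rw [Finset.sum_empty, Finset.sum_empty]
    exact det_eq_zero_of_row_eq_zero v fun i => by simp
  | insert a s ha ih => rw [Finset.sum_insert ha, Finset.sum_insert ha, det_updateRow_add, ih]

/-- The "two-sided cofactor": `C v j i = det ((N.updateRow v e_j).updateRow i e_v)`.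
[cite: Smith2016CongruentDensity, §2.1 (chunk p0006 L44–L48)] -/
def twoCof (N : Matrix n n R) (v j i : n) : R :=
  ((N.updateRow v (Pi.single j 1)).updateRow i (Pi.single v 1)).det

/-- **Row-then-column expansion at `v`**: `det N = N v v · det (unitize N v) +
Σ_{j ≠ v} Σ_{i ≠ v} N v j · N i v · C v j i` (Laplace along row `v`, then along column `v` of each
cofactor). [cite: Smith2016CongruentDensity, §2.1 (chunk p0006 L44–L48)] -/
theorem det_eq_corner_add_sum_twoCof (N : Matrix n n R) (v : n) :
    N.det = N v v * (unitize N v).det +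
      ∑ j ∈ Finset.univ.erase v, ∑ i ∈ Finset.univ.erase v, N v j * N i v * twoCof N v j i := by
  rw [det_eq_sum_mul_adjugate_row N v, ← Finset.add_sum_erase _ _ (Finset.mem_univ v),
    adjugate_apply, det_unitize]
  congr 1
  refine Finset.sum_congr rfl fun j hj => ?_
  have hjv : j ≠ v := Finset.ne_of_mem_erase hj
  rw [adjugate_apply, det_eq_sum_mul_adjugate_col (N.updateRow v (Pi.single j 1)) v,
    ← Finset.add_sum_erase _ _ (Finset.mem_univ v), updateRow_self]
  have h0 : (Pi.single j (1 : R) : n → R) v = 0 := by simp [hjv.symm]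
  rw [h0, zero_mul, zero_add, Finset.mul_sum]
  refine Finset.sum_congr rfl fun i hi => ?_
  have hiv : i ≠ v := Finset.ne_of_mem_erase hi
  rw [updateRow_ne hiv, adjugate_apply, twoCof]
  ring

/-- **The bordered determinant as a quadratic form in the symBorder**: for `w v = 0`,
`det (symBorder N v w) = Σ_{j ≠ v} Σ_{i ≠ v} w j · w i · C v j i`.
[cite: Smith2016CongruentDensity, §2.2 (chunk p0008 L42)] -/
theorem det_border_eq_sum_twoCof (N : Matrix n n R) (v : n) (w : n → R) (hw : w v = 0) :
    (symBorder N v w).det =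
      ∑ j ∈ Finset.univ.erase v, ∑ i ∈ Finset.univ.erase v, w j * w i * twoCof N v j i := by
  unfold symBorder
  have hw' : w = ∑ i ∈ Finset.univ.erase v, w i • (Pi.single i (1 : R) : n → R) := by
    ext a
    by_cases hav : a = v
    · subst hav
      rw [hw, Finset.sum_apply]
      refine (Finset.sum_eq_zero fun i hi => ?_).symm
      simp [(Finset.ne_of_mem_erase hi).symm]
    · rw [Finset.sum_apply, Finset.sum_eq_single a]
      · simp
      · intro b _ hba; simp [Ne.symm hba]
      · intro h; exact absurd (Finset.mem_erase.mpr ⟨hav, Finset.mem_univ a⟩) h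
  conv_lhs => rw [hw']
  rw [det_updateCol_finset_sum, Finset.sum_comm]
  refine Finset.sum_congr rfl fun i hi => ?_
  have hiv : i ≠ v := Finset.ne_of_mem_erase hi
  rw [det_updateCol_smul, det_updateCol_single_eq_det_updateRow_single,
    updateRow_comm _ hiv.symm, det_updateRow_finset_sum, Finset.mul_sum]
  refine Finset.sum_congr rfl fun j _ => ?_
  rw [det_updateRow_smul, updateRow_comm _ hiv, twoCof]
  ring

end CommRing

section ZModTwo

/-- The quadratic form of the two-sided cofactors at `v`:
`quadCof N v x = Σ_{j ≠ v} Σ_{i ≠ v} x j · x i · C v j i` (so that `det (symBorder N v w) = quadCof N v w`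
for `w v = 0`). [cite: Smith2016CongruentDensity, §2.1 (chunk p0006 L44–L48)] -/
def quadCof (N : Matrix n n (ZMod 2)) (v : n) (x : n → ZMod 2) : ZMod 2 :=
  ∑ j ∈ Finset.univ.erase v, ∑ i ∈ Finset.univ.erase v, x j * x i * twoCof N v j i

/-- Over `𝔽₂` and for symmetric `N`, the quadratic form `quadCof N v` is ADDITIVE (the two cross
terms agree by the symmetry `C v j i = C v i j` and cancel since `2 = 0`).
[cite: Smith2016CongruentDensity, §2.1 (chunk p0006 L44–L48)] -/
theorem quadCof_add {N : Matrix n n (ZMod 2)} (hN : Nᵀ = N) (v : n) (x y : n → ZMod 2) :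
    quadCof N v (x + y) = quadCof N v x + quadCof N v y := by
  unfold quadCof
  have hcross : ∑ j ∈ Finset.univ.erase v, ∑ i ∈ Finset.univ.erase v, x j * y i * twoCof N v j i =
      ∑ j ∈ Finset.univ.erase v, ∑ i ∈ Finset.univ.erase v, y j * x i * twoCof N v j i := by
    rw [Finset.sum_comm]
    refine Finset.sum_congr rfl fun j hj => Finset.sum_congr rfl fun i hi => ?_
    rw [twoCof, twoCof, det_updateRow_updateRow_symm hN (Finset.ne_of_mem_erase hi)
      (Finset.ne_of_mem_erase hj)]
    ring
  have h2 : ∀ z : ZMod 2, z + z = 0 := fun z => CharTwo.add_self_eq_zero z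
  calc ∑ j ∈ Finset.univ.erase v, ∑ i ∈ Finset.univ.erase v,
        (x + y) j * (x + y) i * twoCof N v j i
      = (∑ j ∈ Finset.univ.erase v, ∑ i ∈ Finset.univ.erase v, x j * x i * twoCof N v j i) +
        (∑ j ∈ Finset.univ.erase v, ∑ i ∈ Finset.univ.erase v, y j * y i * twoCof N v j i) +
        ((∑ j ∈ Finset.univ.erase v, ∑ i ∈ Finset.univ.erase v, x j * y i * twoCof N v j i) +
         ∑ j ∈ Finset.univ.erase v, ∑ i ∈ Finset.univ.erase v, y j * x i * twoCof N v j i) := by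
        simp only [Pi.add_apply, add_mul, mul_add, Finset.sum_add_distrib]
        ring
    _ = _ := by rw [hcross, h2, add_zero]

/-- Homogeneity: `quadCof N v (c • x) = c · quadCof N v x` (`c² = c` in `𝔽₂`).
[cite: Smith2016CongruentDensity, §2.1 (chunk p0006 L44–L48)] -/
theorem quadCof_smul (N : Matrix n n (ZMod 2)) (v : n) (c : ZMod 2) (x : n → ZMod 2) :
    quadCof N v (c • x) = c * quadCof N v x := by
  unfold quadCof
  rw [Finset.mul_sum]
  refine Finset.sum_congr rfl fun j _ => ?_
  rw [Finset.mul_sum]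
  refine Finset.sum_congr rfl fun i _ => ?_
  simp only [Pi.smul_apply, smul_eq_mul]
  have hc := Literature.LinearAlgebra.QuadraticForm.zmod_two_mul_self c
  calc c * x j * (c * x i) * twoCof N v j i = (c * c) * (x j * x i * twoCof N v j i) := by ring
    _ = c * (x j * x i * twoCof N v j i) := by rw [hc]

/-- Linearity over finite sums: `quadCof N v (Σ_α c α • w α) = Σ_α c α · quadCof N v (w α)`.
[cite: Smith2016CongruentDensity, §2.1 (chunk p0006 L44–L48)] -/
theorem quadCof_sum {N : Matrix n n (ZMod 2)} (hN : Nᵀ = N) (v : n) {ι : Type*} [DecidableEq ι]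
    (A : Finset ι) (c : ι → ZMod 2) (w : ι → n → ZMod 2) :
    quadCof N v (∑ α ∈ A, c α • w α) = ∑ α ∈ A, c α * quadCof N v (w α) := by
  induction A using Finset.induction_on with
  | empty =>
    rw [Finset.sum_empty, Finset.sum_empty]
    unfold quadCof
    exact Finset.sum_eq_zero fun j _ => Finset.sum_eq_zero fun i _ => by simp
  | insert a A ha ih =>
    rw [Finset.sum_insert ha, Finset.sum_insert ha, quadCof_add hN, quadCof_smul, ih]

/-- **Peeling a vertex of a symmetric matrix over `𝔽₂`.** If `N` is symmetric and the
off-diagonal part of row `v` decomposes as `N v j = Σ_{α ∈ A} c α · w α j` (`j ≠ v`) with vectors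
`w α` vanishing at `v`, then `det N = N v v · det (unitize N v) + Σ_α c α · det (symBorder N v (w α))`:
the cross terms cancel in pairs by symmetry (`σ ↔ σ⁻¹`) and `c α ² = c α`.
[cite: Smith2016CongruentDensity, §2.1 (chunk p0006 L44–L48)] -/
theorem det_eq_peel_of_decomp {N : Matrix n n (ZMod 2)} (hN : Nᵀ = N) (v : n) {ι : Type*}
    [DecidableEq ι] (A : Finset ι) (c : ι → ZMod 2) (w : ι → n → ZMod 2)
    (hw : ∀ α ∈ A, w α v = 0) (hrow : ∀ j, j ≠ v → N v j = ∑ α ∈ A, c α * w α j) :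
    N.det = N v v * (unitize N v).det + ∑ α ∈ A, c α * (symBorder N v (w α)).det := by
  rw [det_eq_corner_add_sum_twoCof N v]
  congr 1
  -- the row vector, extended by the decomposition to all of `n`
  set r : n → ZMod 2 := ∑ α ∈ A, c α • w α with hr
  have hrj : ∀ j, j ≠ v → N v j = r j := by
    intro j hj
    rw [hrow j hj, hr, Finset.sum_apply]
    simp only [Pi.smul_apply, smul_eq_mul]
  have hNiv : ∀ i, i ≠ v → N i v = r i := by
    intro i hi
    have h := congrFun (congrFun hN i) v
    rw [transpose_apply] at h
    rw [← h, hrj i hi]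
  calc ∑ j ∈ Finset.univ.erase v, ∑ i ∈ Finset.univ.erase v, N v j * N i v * twoCof N v j i
      = quadCof N v r := by
        unfold quadCof
        refine Finset.sum_congr rfl fun j hj => Finset.sum_congr rfl fun i hi => ?_
        rw [hrj j (Finset.ne_of_mem_erase hj), hNiv i (Finset.ne_of_mem_erase hi)]
    _ = ∑ α ∈ A, c α * quadCof N v (w α) := by rw [hr, quadCof_sum hN]
    _ = ∑ α ∈ A, c α * (symBorder N v (w α)).det := by
        refine Finset.sum_congr rfl fun α hα => ?_
        rw [quadCof, det_border_eq_sum_twoCof N v (w α) (hw α hα)]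

/-- **A unit symBorder is a principal minor**: for `u ≠ v`,
`det (symBorder N v e_u) = det ((N.updateRow u e_u).updateRow v e_v)` (over `𝔽₂`; in general the two
differ by a sign). [cite: Smith2016CongruentDensity, §2.2 (chunk p0008 L42)] -/
theorem det_border_single (N : Matrix n n (ZMod 2)) {u v : n} (huv : u ≠ v) :
    (symBorder N v (Pi.single u 1)).det =
      ((N.updateRow u (Pi.single u 1)).updateRow v (Pi.single v 1)).det := by
  -- expand along column `v` (which is `e_u`)
  unfold symBorder
  rw [det_updateCol_single_eq_det_updateRow_single]
  -- now rows `v ← e_u` and `u ← e_v`; swap the two rows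
  set X := (N.updateRow v (Pi.single u (1 : ZMod 2))).updateRow u (Pi.single v 1) with hX
  have hswap : X.submatrix (Equiv.swap u v) id =
      (N.updateRow u (Pi.single u 1)).updateRow v (Pi.single v 1) := by
    ext i j
    simp only [submatrix_apply, id_eq, hX, updateRow_apply]
    by_cases hiu : i = u
    · subst hiu
      rw [Equiv.swap_apply_left, if_neg huv.symm, if_pos rfl, if_neg huv, if_pos rfl]
    · by_cases hiv : i = v
      · subst hiv
        rw [Equiv.swap_apply_right, if_pos rfl, if_pos rfl]
      · rw [Equiv.swap_apply_of_ne_of_ne hiu hiv, if_neg hiu, if_neg hiv, if_neg hiv, if_neg hiu]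
  rw [← hswap, det_permute, Equiv.Perm.sign_swap huv]
  have hneg : ((-1 : ℤˣ) : ZMod 2) = 1 := by decide
  rw [hneg, one_mul]

/-- `rowColAdd N u u'`: add row `u'` to row `u`, then column `u'` to column `u` (a congruence by
a transvection; determinant-preserving for `u ≠ u'`).
[cite: Smith2016CongruentDensity, §2.1 (Prop. 2.4: `A_Rows[S, S]`, rows re-normalised to a sub-block)] -/
def rowColAdd (N : Matrix n n (ZMod 2)) (u u' : n) : Matrix n n (ZMod 2) :=
  (N.updateRow u (N u + N u')).updateCol u
    (fun i => (N.updateRow u (N u + N u')) i u + (N.updateRow u (N u + N u')) i u')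

omit [Fintype n] in
/-- Entries of `rowColAdd`. [cite: Smith2016CongruentDensity, §2.1 (Prop. 2.4)] -/
theorem rowColAdd_apply (N : Matrix n n (ZMod 2)) (u u' i j : n) :
    rowColAdd N u u' i j = (if i = u then N u j + N u' j else N i j) +
      (if j = u then (if i = u then N u u' + N u' u' else N i u') else 0) := by
  unfold rowColAdd
  simp only [updateCol_apply, updateRow_apply]
  by_cases hju : j = u <;> by_cases hiu : i = u <;> simp [hju, hiu]

/-- `rowColAdd` preserves the determinant (`u ≠ u'`). [cite: Smith2016CongruentDensity, §2.1 (Prop. 2.4)] -/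
theorem det_rowColAdd (N : Matrix n n (ZMod 2)) {u u' : n} (huu' : u ≠ u') :
    (rowColAdd N u u').det = N.det := by
  unfold rowColAdd
  rw [det_updateCol_add_self _ huu', det_updateRow_add_self _ huu']

/-- **Contraction of a symBorder.** For pairwise distinct `u, u', v`:
`det (symBorder N v (e_u + e_{u'})) = det (unitize (unitize (rowColAdd N u u') u') v)`: the congruence
"add row/column `u'` to row/column `u`" turns the symBorder `e_u + e_{u'}` into `e_{u'}` (over `𝔽₂`,
where `1 + 1 = 0`), and a unit symBorder is a principal minor.
[cite: Smith2016CongruentDensity, §2.1 (Prop. 2.4: the matrix `A_Rows[S, S]` re-normalised to a sub-block)] -/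
theorem det_border_single_add_single (N : Matrix n n (ZMod 2)) {u u' v : n} (huu' : u ≠ u')
    (huv : u ≠ v) (hu'v : u' ≠ v) :
    (symBorder N v (Pi.single u 1 + Pi.single u' 1)).det =
      (unitize (unitize (rowColAdd N u u') u') v).det := by
  rw [← det_rowColAdd _ huu']
  have h11 : (1 : ZMod 2) + 1 = 0 := by decide
  have hu'u : u' ≠ u := Ne.symm huu'
  have hvu : v ≠ u := Ne.symm huv
  have hvu' : v ≠ u' := Ne.symm hu'v
  have h2 : rowColAdd (symBorder N v (Pi.single u 1 + Pi.single u' 1)) u u' =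
      symBorder (rowColAdd N u u') v (Pi.single u' 1) := by
    ext i j
    simp only [rowColAdd_apply, border_apply, Pi.add_apply, Pi.single_apply]
    by_cases hiu : i = u <;> by_cases hiu' : i = u' <;> by_cases hiv : i = v <;>
      by_cases hju : j = u <;> by_cases hju' : j = u' <;> by_cases hjv : j = v <;>
      simp_all
  rw [h2, det_border_single _ hu'v, det_unitize_unitize _ hu'v]

end ZModTwo

end Literature.LinearAlgebra.Matrix
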